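import Literature.NumberTheory.DiophantineGeometry.GenEllMell
import Literature.NumberTheory.DiophantineGeometry.GenEllNorthcottProofs
import Literature.NumberTheory.DiophantineGeometry.FaltingsHeightJInvariantProofs
import Mathlib.RingTheory.Polynomial.ScaleRoots
import Mathlib.Data.Nat.Choose.Bounds
import HarnessLib

/-!
# [GenEll] Prop. 3.4 (Faltings Heights and the Divisor at Infinity) — PROOFS

Proof-only companion of `GenEllMell.lean` (abc-iut campaign S; statement file typed by seat
abc-iut-S4; this file = DAG node `GenEll:Prop3.4`, discharged by seat abc-iut-S-d3).
S. Mochizuki, *Arithmetic elliptic curves in general position*, Math. J. Okayama Univ. 52 (2010)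
[cite: MochizukiGenEll2010], Prop. 3.4 (kurims p. 17):

> For any `ε ∈ ℝ_{>0}`, we have `deg_∞ ≲ ht_∞ ≲ 12(1 + ε)·ht^Falt ≲ (1 + ε)·ht_∞` on `M_ell(Q̄)`. In
> particular, if `C ∈ ℝ`, then the set of points `[E] ∈ M_ell(Q̄)^{≤d}` such that `ht^Falt([E]) ≤ C` is
> finite. *Proof.* The first "`≲`" follows immediately from the definitions […]. The remaining
> "`≲`'s" follows from [Silv2], Proposition 2.1 […]. Finally, the finiteness assertion follows
> immediately from the inequalities already shown, together with Proposition 1.4, (iv).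

Everything is PROVED here, with NO residual named fact:

* `prop34_left` — the first `≲`, `deg_∞ ≲ ht_∞` (with constant `0`): by the tree's
  `logHeight₁_j_eq` (Silverman 1986 eq. (10): `log H_F(j) = log N(𝔇) + Σ_{v∣∞} n_v log max(|j|_v, 1)`)
  the difference `ht_∞ − deg_∞` is a sum of nonnegative archimedean terms.
* `prop34Ineq_of_pos` — the three displayed `≲` for every `ε > 0`: the middle and right ones are
  `GenEllMell.prop34_mid_of_silverman` / `prop34_right_of_silverman` applied to the tree's PROOF
  `silverman1986_jHeight_faltingsHeight_holds` of [Silv2] Prop. 2.1 (`FaltingsHeightJInvariantProofs.lean`).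
* `northcott_htInf` — Prop. 1.4 (iv) for `(M̄_ell, 𝒪(∞_M))`, i.e. uniform Northcott for `j`-invariants:
  the points of `M_ell(Q̄)^{≤d}` with `ht_∞ ≤ C` have finitely many `j`-invariants up to conjugacy
  (adapting the argument of `GenEllNorthcottProofs.lean` to NON-minimal presentations `(F, E)`:
  the minimal polynomial of `j` is recovered from that of `N·j` by `scaleRoots`, and
  `deg minpoly(N·j) ≤ deg minpoly(j)` because `N·j` is a root of `(minpoly j).scaleRoots N`).
* `prop34Finite_holds` — the finiteness clause: `ht^Falt ≤ C` and the middle `≲` (at `ε = 1`) give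
  `ht_∞ ≤ 24·C + K`, then `northcott_htInf`.

No new definitions; `GenEllMell.lean` is not edited.
-/

noncomputable section

open NumberField Polynomial Height

namespace Literature.NumberTheory.DiophantineGeometry.GenEll

/-! ## The first `≲`: `deg_∞ ≲ ht_∞` -/

/-- Pointwise form of the first `≲` of [GenEll] Prop. 3.4: `deg_∞([E]) ≤ ht_∞([E])` for every
presented point — `[F:ℚ]⁻¹·log N(𝔇_j) ≤ [F:ℚ]⁻¹·h_F(j)` since
`h_F(j) = log N(𝔇_j) + Σ_{v∣∞} n_v·log max(|j|_v, 1)` (Silverman 1986 eq. (10), tree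
`logHeight₁_j_eq`) and every archimedean term is `≥ 0` ("follows immediately from the definitions").
[cite: MochizukiGenEll2010, Prop 3.4 p.17] -/
theorem EllPoint.degInf_le_htInf (P : EllPoint) : P.degInf ≤ P.htInf := by
  unfold EllPoint.degInf EllPoint.htInf
  refine mul_le_mul_of_nonneg_left ?_ (inv_nonneg.mpr (Nat.cast_nonneg _))
  rw [Literature.NumberTheory.DiophantineGeometry.logHeight₁_j_eq P.W]
  have hsum : 0 ≤ ∑ w : InfinitePlace P.F, (w.mult : ℝ) * Real.log (max (w P.W.j) 1) :=
    Finset.sum_nonneg fun w _ =>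
      mul_nonneg (Nat.cast_nonneg _) (Real.log_nonneg (le_max_right _ _))
  linarith

/-- **[GenEll] Prop. 3.4, first inequality**: `deg_∞ ≲ ht_∞` on `M_ell(Q̄)` (BD-inequality with
constant `0`). PROVED. [cite: MochizukiGenEll2010, Prop 3.4 p.17] -/
theorem prop34_left : BDLe Set.univ EllPoint.degInf EllPoint.htInf :=
  BDLe.of_le fun P _ => P.degInf_le_htInf

/-- **[GenEll] Prop. 3.4, the three displayed inequalities** `deg_∞ ≲ ht_∞ ≲ 12(1+ε)·ht^Falt ≲
(1+ε)·ht_∞` on `M_ell(Q̄)`, for every `ε > 0` — PROVED UNCONDITIONALLY: the [Silv2] Prop. 2.1 input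
of the printed proof is the tree's theorem `silverman1986_jHeight_faltingsHeight_holds`.
[cite: MochizukiGenEll2010, Prop 3.4 p.17] -/
theorem prop34Ineq_of_pos {ε : ℝ} (hε : 0 < ε) : prop34Ineq ε :=
  ⟨prop34_left,
    prop34_mid_of_silverman
      Literature.NumberTheory.DiophantineGeometry.silverman1986_jHeight_faltingsHeight_holds hε,
    prop34_right_of_silverman
      Literature.NumberTheory.DiophantineGeometry.silverman1986_jHeight_faltingsHeight_holds hε⟩

/-! ## Prop. 1.4 (iv) for `ht_∞` on `M_ell`: uniform Northcott for `j`-invariants -/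

/-- A set of presented points with finitely many `j`-invariants up to conjugacy has the same
property on any subset. [cite: MochizukiGenEll2010, Ex 1.3 (i) p.5] -/
theorem MellHasFinitelyManyPoints.mono {S T : Set EllPoint} (h : MellHasFinitelyManyPoints T)
    (hST : S ⊆ T) : MellHasFinitelyManyPoints S :=
  Set.Finite.subset h (Set.image_mono hST)

/-- **[GenEll] Prop. 1.4 (iv) for `(M̄_ell, 𝒪_{M̄_ell}(∞_M))` and the representative `ht_∞`** =
uniform Northcott for `j`-invariants: for every `d : ℕ` and `C : ℝ`, the points `[E] ∈ M_ell(Q̄)^{≤d}`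
(presented over ANY number field `F` of degree `≤ d`, not necessarily `ℚ(j_E)`) with
`ht_∞([E]) = [F:ℚ]⁻¹·h_F(j_E) ≤ C` have only finitely many minimal polynomials `minpoly ℚ j_E`
("There are only finitely many algebraic numbers of bounded degree and bounded height",
Bombieri–Gubler Thm. 1.6.8; the argument of `northcott_UPle_holds`, with the minimality of the
presentation replaced by `deg minpoly(N·j) ≤ deg minpoly(j)`). [cite: BombieriGubler2006, Thm 1.6.8] -/
theorem northcott_htInf (d : ℕ) (C : ℝ) :
    MellHasFinitelyManyPoints {P | P ∈ MellLe d ∧ P.htInf ≤ C} := by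
  classical
  -- the uniform constants
  obtain ⟨H, hH⟩ : ∃ H : ℝ, H = Real.exp (d * max C 0) := ⟨_, rfl⟩
  have hH0 : 0 < H := hH ▸ Real.exp_pos _
  have hH1 : 1 ≤ H := hH ▸ Real.one_le_exp (by positivity)
  obtain ⟨B, hB⟩ : ∃ B : ℕ, B = ⌈max (H * H) 1 ^ d * (2 : ℝ) ^ d⌉₊ := ⟨_, rfl⟩
  have hBR : max (H * H) 1 ^ d * (2 : ℝ) ^ d ≤ B := hB ▸ Nat.le_ceil _
  have hfin : ((fun p : ℕ × ℚ[X] => p.2.scaleRoots ((p.1 : ℚ)⁻¹)) ''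
      (Set.Icc 1 ⌊H⌋₊ ×ˢ {g : ℚ[X] | g.natDegree ≤ d ∧
        ∀ i, g.coeff i ∈ ((↑) : ℤ → ℚ) '' Set.Icc (-(B : ℤ)) B})).Finite :=
    ((Set.finite_Icc _ _).prod
      (finite_setOf_natDegree_le_of_coeff_mem ((Set.finite_Icc _ _).image _) d)).image _
  refine hfin.subset ?_
  rintro _ ⟨P, ⟨hdeg, hPC⟩, rfl⟩
  -- `P = (F, E)`, `n = [F:ℚ] ≤ d`, `h_F(j) = n · ht_∞ P ≤ d · max C 0`
  have hn : Module.finrank ℚ P.F ≤ d := hdeg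
  have hdegR : (0 : ℝ) < P.degree := Nat.cast_pos.mpr P.degree_pos
  have hPC' : (P.degree : ℝ)⁻¹ * logHeight₁ P.W.j ≤ C := hPC
  have hlog : logHeight₁ P.W.j ≤ d * max C 0 := by
    have h1 : logHeight₁ P.W.j = P.degree * ((P.degree : ℝ)⁻¹ * logHeight₁ P.W.j) := by
      rw [mul_inv_cancel_left₀ hdegR.ne']
    rw [h1]
    have hdegd : (P.degree : ℝ) ≤ d := by exact_mod_cast hn
    calc (P.degree : ℝ) * ((P.degree : ℝ)⁻¹ * logHeight₁ P.W.j)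
        ≤ P.degree * max C 0 :=
          mul_le_mul_of_nonneg_left (hPC'.trans (le_max_left _ _)) hdegR.le
      _ ≤ d * max C 0 := mul_le_mul_of_nonneg_right hdegd (le_max_right _ _)
  have hmH : mulHeight₁ P.W.j ≤ H := by
    have h1 : Real.exp (logHeight₁ P.W.j) = mulHeight₁ P.W.j := by
      rw [logHeight₁_eq_log_mulHeight₁, Real.exp_log (mulHeight₁_pos _)]
    rw [← h1, hH]
    exact Real.exp_le_exp.mpr hlog
  -- the denominator `N ≤ H_F(j) ≤ H`, `N · j` integral
  obtain ⟨N, hN0, hNle, hNint⟩ := NumberField.exists_nat_le_mulHeight₁ P.W.j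
  have hNH : (N : ℝ) ≤ H := hNle.trans hmH
  have hN1 : 1 ≤ N := Nat.one_le_iff_ne_zero.mpr hN0
  have hNmax : N ≤ ⌊H⌋₊ := Nat.le_floor hNH
  have hN' : (N : P.F) ≠ 0 := Nat.cast_ne_zero.mpr hN0
  obtain ⟨y, hy⟩ : ∃ y : P.F, y = (N : P.F) * P.W.j := ⟨_, rfl⟩
  have hyint : IsIntegral ℤ y := hy ▸ hNint
  -- all conjugates of `y = N j` are bounded by `H²`
  have hφy : ∀ φ : P.F →+* ℂ, ‖φ y‖ ≤ H * H := fun φ => by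
    rw [hy, map_mul, map_natCast, norm_mul, Complex.norm_natCast]
    exact mul_le_mul hNH ((norm_embedding_le_mulHeight₁ φ P.W.j).trans hmH) (norm_nonneg _) hH0.le
  -- hence the (integer) coefficients of `minpoly ℚ y` are bounded by `B`
  have hcoef : ∀ i, ‖(minpoly ℚ y).coeff i‖ ≤ (B : ℝ) := fun i => by
    have h := NumberField.Embeddings.coeff_bdd_of_norm_le (A := ℂ) hφy i
    refine h.trans (le_trans ?_ hBR)
    refine mul_le_mul (pow_le_pow_right₀ (le_max_right _ _) hn) ?_ (Nat.cast_nonneg _)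
      (pow_nonneg (zero_le_one.trans (le_max_right _ _)) _)
    calc ((Module.finrank ℚ P.F).choose (Module.finrank ℚ P.F / 2) : ℝ)
        ≤ (2 : ℝ) ^ Module.finrank ℚ P.F := by exact_mod_cast Nat.choose_le_two_pow _ _
      _ ≤ 2 ^ d := pow_le_pow_right₀ one_le_two hn
  have hmap : minpoly ℚ y = (minpoly ℤ y).map (algebraMap ℤ ℚ) :=
    minpoly.isIntegrallyClosed_eq_field_fractions' ℚ hyint
  have hgcoef : ∀ i, (minpoly ℚ y).coeff i ∈ ((↑) : ℤ → ℚ) '' Set.Icc (-(B : ℤ)) B := fun i => by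
    have hci : (minpoly ℚ y).coeff i = (((minpoly ℤ y).coeff i : ℤ) : ℚ) := by
      rw [hmap, coeff_map, eq_intCast]
    have habs : |(((minpoly ℤ y).coeff i : ℤ) : ℝ)| ≤ B := by
      have h := hcoef i
      rwa [hci, Int.norm_cast_rat, Int.norm_eq_abs] at h
    refine ⟨(minpoly ℤ y).coeff i, ⟨?_, ?_⟩, hci.symm⟩
    · have h := (abs_le.mp habs).1
      exact_mod_cast h
    · have h := (abs_le.mp habs).2
      exact_mod_cast h
  have hgdeg : (minpoly ℚ y).natDegree ≤ d := (minpoly.natDegree_le y).trans hn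
  -- reconstruct `minpoly ℚ j` from `minpoly ℚ (N j)` by rescaling the roots by `N⁻¹`
  have hyx : algebraMap ℚ P.F ((N : ℚ)⁻¹) * y = P.W.j := by
    rw [map_inv₀, map_natCast, hy, inv_mul_cancel_left₀ hN']
  have hroot : aeval P.W.j ((minpoly ℚ y).scaleRoots ((N : ℚ)⁻¹)) = 0 := by
    have h := scaleRoots_aeval_eq_zero (A := P.F) (r := ((N : ℚ)⁻¹)) (minpoly.aeval ℚ y)
    rwa [hyx] at h
  have hfmonic : ((minpoly ℚ y).scaleRoots ((N : ℚ)⁻¹)).Monic :=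
    (monic_scaleRoots_iff _).2 (minpoly.monic (Algebra.IsIntegral.isIntegral y))
  have hdvd : minpoly ℚ P.W.j ∣ (minpoly ℚ y).scaleRoots ((N : ℚ)⁻¹) := minpoly.dvd ℚ P.W.j hroot
  -- conversely `y = N · j` is a root of `(minpoly ℚ j).scaleRoots N`, so the degrees agree
  have hxy : algebraMap ℚ P.F (N : ℚ) * P.W.j = y := by
    rw [map_natCast, hy]
  have hroot' : aeval y ((minpoly ℚ P.W.j).scaleRoots (N : ℚ)) = 0 := by
    have h := scaleRoots_aeval_eq_zero (A := P.F) (r := (N : ℚ)) (minpoly.aeval ℚ P.W.j)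
    rwa [hxy] at h
  have hgmonic : ((minpoly ℚ P.W.j).scaleRoots (N : ℚ)).Monic :=
    (monic_scaleRoots_iff _).2 (minpoly.monic (Algebra.IsIntegral.isIntegral P.W.j))
  have hdvd' : minpoly ℚ y ∣ (minpoly ℚ P.W.j).scaleRoots (N : ℚ) := minpoly.dvd ℚ y hroot'
  have hdegle : ((minpoly ℚ y).scaleRoots ((N : ℚ)⁻¹)).natDegree ≤ (minpoly ℚ P.W.j).natDegree := by
    rw [natDegree_scaleRoots]
    have h := natDegree_le_of_dvd hdvd' hgmonic.ne_zero
    rwa [natDegree_scaleRoots] at h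
  have hrecon : (minpoly ℚ y).scaleRoots ((N : ℚ)⁻¹) = minpoly ℚ P.W.j :=
    eq_of_monic_of_dvd_of_natDegree_le (minpoly.monic (Algebra.IsIntegral.isIntegral P.W.j))
      hfmonic hdvd hdegle
  exact ⟨(N, minpoly ℚ y), ⟨⟨hN1, hNmax⟩, hgdeg, hgcoef⟩, hrecon⟩

/-! ## The finiteness clause -/

/-- **[GenEll] Prop. 3.4, finiteness clause** — PROVED UNCONDITIONALLY: for every positive integer
`d` and every `C ∈ ℝ`, the points `[E] ∈ M_ell(Q̄)^{≤d}` with `ht^Falt([E]) ≤ C` are finitely many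
(finitely many `j`-invariants up to conjugacy). Printed proof: "follows immediately from the
inequalities already shown, together with Proposition 1.4, (iv)" — here: the middle `≲` at `ε = 1`
(`ht_∞ ≤ 24·ht^Falt + K`, Silverman 1986 Prop. 2.1, proved in the tree) bounds `ht_∞` by `24·C + K`,
and `northcott_htInf` (Prop. 1.4 (iv) for `ht_∞`) finishes. [cite: MochizukiGenEll2010, Prop 3.4 p.17] -/
theorem prop34Finite_holds : prop34Finite := by
  intro d C
  obtain ⟨K, hK⟩ := prop34_mid_of_silverman
    Literature.NumberTheory.DiophantineGeometry.silverman1986_jHeight_faltingsHeight_holds one_pos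
  refine (northcott_htInf d (24 * C + K)).mono ?_
  rintro P ⟨hPd, hPC⟩
  refine ⟨hPd, ?_⟩
  have h := hK P (Set.mem_univ P)
  change P.htInf - 12 * (1 + 1) * P.htFalt ≤ K at h
  linarith

end Literature.NumberTheory.DiophantineGeometry.GenEll

end
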